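import Summits.CriticalPhenomena.PercolationContinuityZ3.Theorems.Transplant.PlanarSkeletonFrmQuasiDefs
import Summits.CriticalPhenomena.PercolationContinuityZ3.Theorems.Transplant.SkelFrmQuasiBParamsFaceTop
import Summits.CriticalPhenomena.PercolationContinuityZ3.Theorems.Transplant.SkelFrmBParamsFaceTop
import Summits.CriticalPhenomena.PercolationContinuityZ3.Theorems.Transplant.SkelFrmQuasiBParamsFaceUnits
import Summits.CriticalPhenomena.PercolationContinuityZ3.Theorems.Transplant.SkelFrmBParamsFaceUnits
import Summits.CriticalPhenomena.PercolationContinuityZ3.Theorems.Transplant.SkelFrmQuasiBParamsSchedA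
import Summits.CriticalPhenomena.PercolationContinuityZ3.Theorems.Transplant.SkelFrmBParamsSchedA
import Summits.CriticalPhenomena.PercolationContinuityZ3.Theorems.Transplant.SkelFrmQuasiBParamsSlotsTA
import Summits.CriticalPhenomena.PercolationContinuityZ3.Theorems.Transplant.SkelFrmBParamsSlotsTA
import Summits.CriticalPhenomena.PercolationContinuityZ3.Theorems.Transplant.SkelFrmQuasiBParamsFineSizeA
import Summits.CriticalPhenomena.PercolationContinuityZ3.Theorems.Transplant.SkelFrmBParamsFineSizeA
import Summits.CriticalPhenomena.PercolationContinuityZ3.Theorems.Transplant.SkelFrmQuasiBParamsLOA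
import Summits.CriticalPhenomena.PercolationContinuityZ3.Theorems.Transplant.SkelFrmBParamsLOA
import Summits.CriticalPhenomena.PercolationContinuityZ3.Theorems.Transplant.SkelNegBParamsFaceTopA
import Summits.CriticalPhenomena.PercolationContinuityZ3.Theorems.Transplant.SkelFrmQuasiBParamsLF
import HarnessLib
import Summits.CriticalPhenomena.PercolationContinuityZ3.Theorems.Transplant.SkelFrmBParamsFaceTopA
/-!
# GEN-Q PORT (WAVE-Q table v0.8 section 2, row G104, U-level L13; captain R-6/R-7 2026-08-27: carrier token swap `PlanarSkeletonFrmFrom ↦ PlanarSkeletonFrmQuasi`)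
# of the tree module «Transplant/SkelFrmFromBParamsFaceTopA» (sha256 9dc8d12b56940b52…) onto the quasi-step carrier `PlanarSkeletonFrmQuasi` (p507026): «SkelFrmQuasiBParamsFaceTopA»

ORIGINAL TITLE: N2 (frames-only node `SamePDropOfSkeletonFrmFrom₁`, OPEN) params column over `PlanarSkeletonFrm` — (ζ″) ledger, shape (B′) of record ((R-14)):

builds on p205010 (kernel theorem, internal audit signed; external expert review pending) — nothing in this file uses p205010; NOTHING is claimed about any open node
((N3-b), the end state).  Lane `prim-bschramm`, seat `prim-bschramm-stmt` (gen 33; GEN-Q column pen; tool = captain gen-1 g4's port_genq.py R-14 --cone + p3-g30's T1 patch).  Helper file (`--supports stmt-CriticalPhenomena-4575 --as helper`).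
PORT RULES (U-wave r1–r4 re-used, GEN-Q hunk classes of p3-g29 #6136): declaration order, names and proof texts are those of «SkelFrmFromBParamsFaceTopA», byte-identical except
(i) the carrier token `PlanarSkeletonFrmFrom ↦ PlanarSkeletonFrmQuasi` in binders, `namespace`/`end` lines and qualified names (module names `SkelFrmFrom… ↦ SkelFrmQuasi…`
in imports of already-ported rows); (ii) `Φ.step ↦ Φ.qstep` with the called Steps lemma replaced by its `…Q`/`_q` twin and the cost `Φ.M` threaded (none in this file unless
listed below); (iii) `Φ.cyl_connected ↦ Φ.cyl_reach` readers (none unless listed); (iv) graph-ball radii / window floors ×`Φ.M` (none unless listed).  Carrier-free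
residents stay imported/exported from the original «SkelFrmBParamsFaceTopA» exactly as in the FrmFrom port.  Docstrings and citations are the original's.

-/

noncomputable section

open scoped Classical

namespace Summit.CriticalPhenomena.PercolationContinuityZ3.Theorems.Transplant

namespace PlanarSkeletonFrmQuasi

namespace NegB

open Literature.Probability.Percolation Literature.Probability.LatticeModels SimpleGraph
open SkelConc (Consts)
open Skelφ (shearUnit)
open Skelφ.StepI (DataN)
open TwoAxis.Para (modulus)
open Neg

/-! ## §1 The (ζ′) lattice record's unit / determinant / top-layer facts -/

section Lattice

-- GEN-Q (R-2, captain 2026-08-27): `PlanarSkeletonFrmFrom.NegB.c₀_eq_A_mul_u₀A` is not in the used cone of the node top — not ported.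

-- GEN-Q (R-2, captain 2026-08-27): `PlanarSkeletonFrmFrom.NegB.c₁_eq_A_mul_u₁A` is not in the used cone of the node top — not ported.

-- GEN-Q (R-2, captain 2026-08-27): `PlanarSkeletonFrmFrom.NegB.u_nonnegA` is not in the used cone of the node top — not ported.

/-- **`D_A = A²·m`** at the record's own fields (hp-8's `hD` with `mod := modulus n_L h_L v_L v_β`). [folklore] -/
theorem D_eq_A_sq_mulA (κ : Consts) {V : Type} [DecidableEq V] [Countable V] {G : SimpleGraph V} [G.LocallyFinite] (Φ : PlanarSkeletonFrmQuasi G) (t : V) (p : unitInterval) (D : Skelφ.StepI.DataNS V) (g : ℕ) (f : ℕ) : (prFA κ Φ t p D g f).D =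
    (prFA κ Φ t p D g f).A ^ 2 * modulus ((prFA κ Φ t p D g f).n : ℤ) (prFA κ Φ t p D g f).h (prFA κ Φ t p D g f).vα (prFA κ Φ t p D g f).vβ := by
  obtain ⟨hA, hn, hh, hv, hvb, -, -, hD⟩ := prFA_fields κ Φ t p D g f
  rw [hD, hA, hn, hh, hv, hvb]; exact KS.DofA_eq' κ Φ t p D g f

-- GEN-Q (R-2, captain 2026-08-27): `PlanarSkeletonFrmFrom.NegB.lattice_RA` is not in the used cone of the node top — not ported.

end Lattice

end NegB

end PlanarSkeletonFrmQuasi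

end Summit.CriticalPhenomena.PercolationContinuityZ3.Theorems.Transplant

end
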